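import Summits.CriticalPhenomena.PercolationContinuityZ3.Theorems.PercNearOneGluingNoHeavyLowerTailFKHullPortTASHolds
import HarnessLib

/-!
# FK sub-lane: (Htw) in world form for the random-cluster measure `φ_{𝐩,q}`, `q ≥ 1` — unconditional

Support file (`--supports stmt-CriticalPhenomena-4575`), FK sub-lane `prim-bschramm-fk-2` (gen 3); builds on p205010 (kernel theorem,
internal audit signed; external expert review pending).  No definitions, no named facts, no sorries; standard axioms.

`FK.htw_world_rc` is the random-cluster twin of the `q = 1` tree theorem `CSH.htw_world` (`…AdditiveGluingCSHHtwBridge.lean`, the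
(Htw) input of hp-8's conditioned slack hierarchy, PROOF-S5-ALL-R (K9)-diagonal): for `φ = rcMeasureW w q ∅`, `q ≥ 1`, an owner
`x ∈ S`, an observer `v ∉ S`, a marker `o`, an avoided set `Y` whose weight-one pairs lie inside `Y`, and every monotone `g`,
  `φ(v ↮ S ∪ Y, o ↔ v) · ∫_{x ↮ Y} Cov_{φ^ω}(g(C_x), 1{v ↔ S}) dφ(ω) ≤ φ(v ↮ S ∪ Y) · ∫_{x ↮ Y} p_ω · Cov_{φ^ω}(g(C_x), 1{v ↔ S}) dφ(ω)`,
`p_ω = φ^ω(o ↔ v | v ↮ S)`, where the WORLD `φ^ω = rcMeasureW (delW w {pairs meeting the open vertex cluster of Y in ω}) q ∅` is the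
random-cluster measure with those pairs deleted and the same `q` (vdBHK Lemma 2.3) — with `prodBernoulli` and zeroed weights replaced by
`rcMeasureW`/`delW`.  It is `FK.taQS_nonneg` (`T^S ≥ 0`, this cell) read through the dictionary `FK.TS_integral_identity_rc`
(sum functionals `FK.taBS/taAS/tabS/taaS` = `Z`-multiples of the integrals).  bschramm/FK-Q2.md §12.6(c), §12.10.
[cite: VandenbergHaggstromKahn2005, Thm. 1.4 (p. 7), §2.1 eq. (11), Lemma 2.3 (p. 10)] [cite: Gladkov2024, Thm. 3.2 (p. 4)]
[cite: Grimmett2006, §1.4 eq. (1.20) (p. 15), Thm. (3.8)(b)]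
-/

noncomputable section

namespace Summit.CriticalPhenomena.PercolationContinuityZ3.Theorems.FK

open MeasureTheory Set Literature.Probability.LatticeModels Literature.Probability.Percolation
open Literature.Probability.Percolation.DecisionTree (ind ind_of_mem ind_of_not_mem ind_nonneg)
open Literature.Probability.Percolation.BHK2006 (rcMass rcMass_nonneg delW rcMeasureW_real_eq_sum_rcMass
  setIntegral_rcMeasureW_eq_sum integral_rcMeasureW_eq_sum ind_inter)
open Summit.CriticalPhenomena.PercolationContinuityZ3.Theorems.HullPort (cut avoidEv connS)
open scoped Classical

variable {V : Type*} [Fintype V]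

/-- **(Htw) in world form for `φ_{𝐩,q}`, `q ≥ 1` — unconditional** (the random-cluster twin of `CSH.htw_world`): for `x ∈ S`, `v ∉ S`,
every avoided set `Y` whose weight-one pairs lie inside `Y`, every marker `o` and every monotone `g`,
`φ(v↮S∪Y, o↔v)·∫_{x↮Y} Cov_{φ^ω}(g(C_x),1{v↔S}) dφ ≤ φ(v↮S∪Y)·∫_{x↮Y} p_ω·Cov_{φ^ω}(g(C_x),1{v↔S}) dφ`, `p_ω = φ^ω(o↔v | v↮S)`,
`φ^ω` the random-cluster measure with the pairs meeting the vertex cluster of `Y` deleted (same `q`).  From `FK.taQS_nonneg`.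
[cite: VandenbergHaggstromKahn2005, Thm. 1.4 (p. 7), §2.1 Lemma 2.3 (p. 10)] [cite: Gladkov2024, Thm. 3.2 (p. 4)] [cite: Grimmett2006, Thm. (3.8)(b)] -/
theorem htw_world_rc (w : Sym2 V → unitInterval) {q : ℝ} (hq : 1 ≤ q) (x : V) (Y : Set V) (S : Finset V) (hxS : x ∈ S)
    (o v : V) (hvS : v ∉ S) (hINV : ∀ p : Sym2 V, ((w p : unitInterval) : ℝ) = 1 → ∀ u ∈ p, u ∈ Y)
    (g : Set (Sym2 V) → ℝ) (hg : Monotone g) :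
    (rcMeasureW w q ∅).real ({ω : BondConfig V | ∀ a ∈ (↑S ∪ Y : Set V), ¬ (openGraph ω).Reachable v a} ∩ openConn o v) *
        (∫ ω in {ω : BondConfig V | ∀ y ∈ Y, ¬ (openGraph ω).Reachable x y},
          ((∫ η in (⋃ t ∈ S, (openConn v t : Set (BondConfig V))), g (openEdgeCluster η x)
              ∂(rcMeasureW (delW w {e | ∃ z ∈ e, ∃ y ∈ Y, (openGraph ω).Reachable y z}) q ∅)) -
            (rcMeasureW (delW w {e | ∃ z ∈ e, ∃ y ∈ Y, (openGraph ω).Reachable y z}) q ∅).real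
                (⋃ t ∈ S, (openConn v t : Set (BondConfig V))) *
              (∫ η, g (openEdgeCluster η x)
                ∂(rcMeasureW (delW w {e | ∃ z ∈ e, ∃ y ∈ Y, (openGraph ω).Reachable y z}) q ∅)))
          ∂(rcMeasureW w q ∅)) ≤
      (rcMeasureW w q ∅).real {ω : BondConfig V | ∀ a ∈ (↑S ∪ Y : Set V), ¬ (openGraph ω).Reachable v a} *
        (∫ ω in {ω : BondConfig V | ∀ y ∈ Y, ¬ (openGraph ω).Reachable x y},
          ((rcMeasureW (delW w {e | ∃ z ∈ e, ∃ y ∈ Y, (openGraph ω).Reachable y z}) q ∅).real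
                ({η : BondConfig V | ∀ t ∈ S, ¬ (openGraph η).Reachable v t} ∩ openConn o v) /
              (rcMeasureW (delW w {e | ∃ z ∈ e, ∃ y ∈ Y, (openGraph ω).Reachable y z}) q ∅).real
                {η : BondConfig V | ∀ t ∈ S, ¬ (openGraph η).Reachable v t}) *
          ((∫ η in (⋃ t ∈ S, (openConn v t : Set (BondConfig V))), g (openEdgeCluster η x)
              ∂(rcMeasureW (delW w {e | ∃ z ∈ e, ∃ y ∈ Y, (openGraph ω).Reachable y z}) q ∅)) -
            (rcMeasureW (delW w {e | ∃ z ∈ e, ∃ y ∈ Y, (openGraph ω).Reachable y z}) q ∅).real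
                (⋃ t ∈ S, (openConn v t : Set (BondConfig V))) *
              (∫ η, g (openEdgeCluster η x)
                ∂(rcMeasureW (delW w {e | ∃ z ∈ e, ∃ y ∈ Y, (openGraph ω).Reachable y z}) q ∅)))
          ∂(rcMeasureW w q ∅)) := by
  classical
  have hq0 : 0 < q := one_pos.trans_le hq
  set Z : ℝ := rcPartitionFunctionW w q ∅ with hZ
  have hZpos : 0 < Z := rcPartitionFunctionW_pos w hq0 ∅
  -- the events in the vocabulary of the owner-set functionals
  have hU : (⋃ t ∈ S, (openConn v t : Set (BondConfig V))) = (connS (↑S : Set V) v : Set (Set (Sym2 V))) := by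
    ext η
    simp only [Set.mem_iUnion, exists_prop, Finset.mem_coe, connS, Set.mem_setOf_eq, openConn]
  have hN : {η : BondConfig V | ∀ t ∈ S, ¬ (openGraph η).Reachable v t} = (connS (↑S : Set V) v : Set (Set (Sym2 V)))ᶜ := by
    ext η
    simp only [Set.mem_setOf_eq, Set.mem_compl_iff, connS, not_exists, not_and, Finset.mem_coe]
  have hoc : (openConn o v : Set (BondConfig V)) = openConn v o := by
    ext η
    simp only [openConn, Set.mem_setOf_eq]
    exact ⟨fun h => h.symm, fun h => h.symm⟩
  have hD : ∀ ω : BondConfig V, ind {ω : BondConfig V | ∀ y ∈ Y, ¬ (openGraph ω).Reachable x y} ω = ind (avoidEv x Y) ω :=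
    fun ω => rfl
  rw [hU, hN, hoc]
  -- outer events as unnormalised sums
  have hb : (rcMeasureW w q ∅).real {ω : BondConfig V | ∀ a ∈ (↑S ∪ Y : Set V), ¬ (openGraph ω).Reachable v a} =
      tabS w q (↑S : Set V) v Y / Z := by
    rw [rcMeasureW_real_eq_sum_div w hq0 ∅]; rfl
  have ha : (rcMeasureW w q ∅).real ({ω : BondConfig V | ∀ a ∈ (↑S ∪ Y : Set V), ¬ (openGraph ω).Reachable v a} ∩
      openConn v o) = taaS w q (↑S : Set V) v o Y / Z := by
    rw [rcMeasureW_real_eq_sum_div w hq0 ∅]; rfl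
  -- world quantities as `FK.wE` expectations
  have hwr : ∀ (ω : BondConfig V) (E : Set (BondConfig V)),
      (rcMeasureW (delW w {e | ∃ z ∈ e, ∃ y ∈ Y, (openGraph ω).Reachable y z}) q ∅).real E = wE w q (cut Y ω) (ind E) := by
    intro ω E; rw [rcMeasureW_real_eq_sum_rcMass _ hq0]; rfl
  have hwi1 : ∀ ω : BondConfig V,
      ∫ η in (connS (↑S : Set V) v : Set (Set (Sym2 V))), g (openEdgeCluster η x)
          ∂(rcMeasureW (delW w {e | ∃ z ∈ e, ∃ y ∈ Y, (openGraph ω).Reachable y z}) q ∅) =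
        wE w q (cut Y ω) (fun ζ => g (openEdgeCluster ζ x) * ind (connS (↑S : Set V) v) ζ) := by
    intro ω; rw [setIntegral_rcMeasureW_eq_sum _ hq0]; rfl
  have hwi2 : ∀ ω : BondConfig V,
      ∫ η, g (openEdgeCluster η x) ∂(rcMeasureW (delW w {e | ∃ z ∈ e, ∃ y ∈ Y, (openGraph ω).Reachable y z}) q ∅) =
        wE w q (cut Y ω) (fun ζ => g (openEdgeCluster ζ x)) := by
    intro ω; rw [integral_rcMeasureW_eq_sum _ hq0]; rfl
  rw [setIntegral_rcMeasureW_eq_sum w hq0, setIntegral_rcMeasureW_eq_sum w hq0]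
  simp only [hb, ha, hwr, hwi1, hwi2, hD]
  have hmass : ∀ ω : BondConfig V, rcMass w q ω = rcWeightW w q ∅ ω / Z := fun ω => rfl
  simp only [hmass]
  -- both sides as `Z⁻²`-multiples of the owner-set functionals
  have hL : ∑ ω, rcWeightW w q ∅ ω / Z *
      ((wE w q (cut Y ω) (fun ζ => g (openEdgeCluster ζ x) * ind (connS (↑S : Set V) v) ζ) -
          wE w q (cut Y ω) (ind (connS (↑S : Set V) v)) * wE w q (cut Y ω) (fun ζ => g (openEdgeCluster ζ x))) *
        ind (avoidEv x Y) ω) = taBS w q x (↑S : Set V) v Y g / Z := by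
    unfold taBS
    rw [Finset.sum_div]
    refine Finset.sum_congr rfl fun ω _ => ?_
    unfold taCS
    field_simp
  have hR : ∑ ω, rcWeightW w q ∅ ω / Z *
      (wE w q (cut Y ω) (ind ((connS (↑S : Set V) v : Set (Set (Sym2 V)))ᶜ ∩ openConn v o)) /
            wE w q (cut Y ω) (ind (connS (↑S : Set V) v : Set (Set (Sym2 V)))ᶜ) *
          (wE w q (cut Y ω) (fun ζ => g (openEdgeCluster ζ x) * ind (connS (↑S : Set V) v) ζ) -
            wE w q (cut Y ω) (ind (connS (↑S : Set V) v)) * wE w q (cut Y ω) (fun ζ => g (openEdgeCluster ζ x))) *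
        ind (avoidEv x Y) ω) = taAS w q x (↑S : Set V) v o Y g / Z := by
    unfold taAS
    rw [Finset.sum_div]
    refine Finset.sum_congr rfl fun ω _ => ?_
    unfold taCS taNS taNWS
    field_simp
  rw [hL, hR]
  have hQ := taQS_nonneg hq (Finset.mem_coe.2 hxS) v (fun h => hvS (Finset.mem_coe.1 h)) g hg w Y hINV o
  unfold taQS at hQ
  rw [div_mul_div_comm, div_mul_div_comm, div_le_div_iff_of_pos_right (mul_pos hZpos hZpos)]
  linarith [hQ]

end Summit.CriticalPhenomena.PercolationContinuityZ3.Theorems.FK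

end
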